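import Mathlib

/-!
# SoloInformedFreeFactor — K20 (soloist `solo-FinalStateConjecture-informed`, session 33) — kernel shadow of CAPS.md §8.10
(THEOREM Q3, the free-product structure of an `F-m.1′` witness on a cap).

Point-set part: the FRONTIER RULE (R4) and the ONE-PIECE LEMMAS (R5)/(R5′) for a family of pairwise
disjoint open sets `B i` (the images of the extra flat components) and an open set `W` (the full late
Kerr image) covering a (pre)connected set `R` (the late cap cylinder).

Algebraic part: the RETRACTION of a free product `Monoid.CoprodI G` onto one factor and its
consequence used in Q3(ii)–(iii): an element conjugate into two DISTINCT free factors is trivial, so a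
non-trivial subgroup is conjugate into at most one free factor (uniqueness of the carrying factor).
-/

namespace Summit.FinalStateConjecture.FinalStateConjecture.Theorems

namespace FreeFactor

open Set Function

section PointSet

variable {X : Type*} [TopologicalSpace X] {ι : Type*}

/-- (R4) FRONTIER RULE: a frontier point of one member `B m` of a pairwise disjoint open family that is
covered by `W ∪ ⋃ i, B i` lies in `W`. -/
theorem frontier_rule (B : ι → Set X) (W : Set X) (hB : ∀ i, IsOpen (B i))
    (hdisj : Pairwise (Disjoint on B)) {m : ι} {p : X}
    (hp : p ∈ closure (B m)) (hpn : p ∉ B m) (hcov : p ∈ W ∪ ⋃ i, B i) : p ∈ W := by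
  rcases hcov with h | h
  · exact h
  · obtain ⟨i, hi⟩ := mem_iUnion.mp h
    by_cases him : i = m
    · subst him; exact absurd hi hpn
    · have hd : Disjoint (B i) (B m) := hdisj him
      obtain ⟨x, hxi, hxm⟩ := mem_closure_iff.mp hp (B i) (hB i) hi
      exact absurd hxm (Set.disjoint_left.mp hd hxi)

/-- (R5) ONE-PIECE LEMMA: a preconnected set covered by `W ∪ ⋃ i, B i` (the `B i` pairwise disjoint
open, `W` open), meeting a member `B m` disjoint from `W`, lies entirely in `B m`. -/
theorem one_piece (B : ι → Set X) (W R : Set X) (hB : ∀ i, IsOpen (B i)) (hW : IsOpen W)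
    (hdisj : Pairwise (Disjoint on B)) (hR : IsPreconnected R) (hcov : R ⊆ W ∪ ⋃ i, B i)
    {m : ι} (hmW : Disjoint (B m) W) (hne : (R ∩ B m).Nonempty) : R ⊆ B m := by
  classical
  set V : Set X := W ∪ ⋃ (i : ι) (_ : i ≠ m), B i with hV
  have hVo : IsOpen V := hW.union (isOpen_iUnion fun i => isOpen_iUnion fun _ => hB i)
  have hcov' : R ⊆ B m ∪ V := by
    intro x hx
    rcases hcov hx with h | h
    · exact Or.inr (Or.inl h)
    · obtain ⟨i, hi⟩ := mem_iUnion.mp h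
      by_cases him : i = m
      · subst him; exact Or.inl hi
      · exact Or.inr (Or.inr (mem_iUnion.mpr ⟨i, mem_iUnion.mpr ⟨him, hi⟩⟩))
  have hBV : ∀ x, x ∈ B m → x ∈ V → False := by
    intro x hxB hxV
    rcases hxV with h | h
    · exact Set.disjoint_left.mp hmW hxB h
    · obtain ⟨i, hi⟩ := mem_iUnion.mp h
      obtain ⟨him, hxi⟩ := mem_iUnion.mp hi
      have hd : Disjoint (B i) (B m) := hdisj him
      exact Set.disjoint_left.mp hd hxi hxB
  have hdj : R ∩ (B m ∩ V) = ∅ := by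
    ext x
    simp only [mem_inter_iff, mem_empty_iff_false, iff_false, not_and]
    exact fun _ hxB hxV => hBV x hxB hxV
  rcases (isPreconnected_iff_subset_of_disjoint.mp hR) (B m) V (hB m) hVo hcov' hdj with h | h
  · exact h
  · exfalso
    obtain ⟨x, hxR, hxB⟩ := hne
    exact hBV x hxB (h hxR)

/-- (R5′) if moreover `R` misses `W`, a non-empty preconnected `R` lies in ONE member of the family. -/
theorem one_piece_of_disjoint (B : ι → Set X) (W R : Set X) (hB : ∀ i, IsOpen (B i))
    (hdisj : Pairwise (Disjoint on B)) (hR : IsPreconnected R) (hcov : R ⊆ W ∪ ⋃ i, B i)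
    (hRW : Disjoint R W) (hne : R.Nonempty) : ∃ m, R ⊆ B m := by
  obtain ⟨x, hx⟩ := hne
  have hcovB : R ⊆ ⋃ i, B i := fun y hy => (hcov hy).resolve_left (Set.disjoint_left.mp hRW hy)
  obtain ⟨m, hm⟩ := mem_iUnion.mp (hcovB hx)
  refine ⟨m, one_piece B ∅ R hB isOpen_empty hdisj hR (fun y hy => Or.inr (hcovB hy))
    (Set.disjoint_empty _) ⟨x, hx, hm⟩⟩

/-- The covered part of the frontier of a member lies in `W`: set version of (R4). -/
theorem frontier_inter_cover_subset (B : ι → Set X) (W : Set X) (hB : ∀ i, IsOpen (B i))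
    (hdisj : Pairwise (Disjoint on B)) (m : ι) :
    (closure (B m) \ B m) ∩ (W ∪ ⋃ i, B i) ⊆ W := by
  rintro p ⟨⟨hp, hpn⟩, hcov⟩
  exact frontier_rule B W hB hdisj hp hpn hcov

end PointSet

section FreeProduct

variable {ι : Type*} [DecidableEq ι] {G : ι → Type*} [∀ i, Group (G i)]

open Monoid

/-- The canonical homomorphism from the free product to the direct product. -/
def toPi : CoprodI G →* (∀ i, G i) := CoprodI.lift fun i => MonoidHom.mulSingle G i

/-- RETRACTION of the free product onto the factor `m` (every other factor is killed). -/
def retract (m : ι) : CoprodI G →* G m := (Pi.evalMonoidHom G m).comp toPi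

/-- the retraction is the identity on its own factor -/
@[simp] theorem retract_of_same (m : ι) (a : G m) : retract m (CoprodI.of a) = a := by
  simp [retract, toPi, CoprodI.lift_of]

/-- the retraction onto `m` kills every other factor -/
theorem retract_of_ne {i m : ι} (h : i ≠ m) (a : G i) :
    retract (G := G) m (CoprodI.of a) = 1 := by
  simp [retract, toPi, CoprodI.lift_of, Pi.mulSingle_eq_of_ne (Ne.symm h)]

/-- `retract m` is a left inverse of the inclusion of the factor `m`; in particular `of` is injective
(re-derived) and the factor `G m` is a retract of the free product. -/
theorem retract_comp_of (m : ι) :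
    (retract (G := G) m).comp (CoprodI.of (i := m)) = MonoidHom.id (G m) := by
  ext a; simp

/-- UNIQUENESS OF THE CARRYING FACTOR (element form): an element of the free product that is
conjugate into the factor `i` AND into the factor `j ≠ i` is trivial. -/
theorem eq_one_of_conj_into_two_factors {i j : ι} (hij : i ≠ j) (g g' x : CoprodI G)
    (a : G i) (b : G j) (ha : x = g * CoprodI.of a * g⁻¹) (hb : x = g' * CoprodI.of b * g'⁻¹) :
    x = 1 := by
  -- apply the retraction onto the factor `i`: the `j`-conjugate dies, so `a` dies.
  have h1 : retract i x = retract i g * a * (retract i g)⁻¹ := by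
    rw [ha]; simp
  have h2 : retract i x = 1 := by
    rw [hb]; simp [retract_of_ne (Ne.symm hij)]
  have h3 : retract i g * a * (retract i g)⁻¹ = 1 := h1 ▸ h2
  have h4 : a = 1 := by
    have := congrArg (fun y => (retract i g)⁻¹ * y * retract i g) h3
    simpa [mul_assoc] using this
  rw [ha, h4]; simp

/-- Subgroup form: a subgroup conjugate into two distinct free factors is trivial.  Hence a
non-trivial subgroup of a free product is conjugate into AT MOST ONE free factor. -/
theorem subgroup_eq_bot_of_conj_into_two_factors {i j : ι} (hij : i ≠ j)
    (H : Subgroup (CoprodI G)) (g g' : CoprodI G)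
    (hi : ∀ x ∈ H, ∃ a : G i, x = g * CoprodI.of a * g⁻¹)
    (hj : ∀ x ∈ H, ∃ b : G j, x = g' * CoprodI.of b * g'⁻¹) : H = ⊥ := by
  rw [Subgroup.eq_bot_iff_forall]
  intro x hx
  obtain ⟨a, ha⟩ := hi x hx
  obtain ⟨b, hb⟩ := hj x hx
  exact eq_one_of_conj_into_two_factors hij g g' x a b ha hb

/-- The form used in Q3(ii)(b): a subgroup lying INSIDE the factor `i` (no conjugation) and conjugate
into a factor `j ≠ i` is trivial. -/
theorem subgroup_eq_bot_of_le_range_of_conj {i j : ι} (hij : i ≠ j)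
    (H : Subgroup (CoprodI G)) (g' : CoprodI G)
    (hi : H ≤ (CoprodI.of (i := i) : G i →* CoprodI G).range)
    (hj : ∀ x ∈ H, ∃ b : G j, x = g' * CoprodI.of b * g'⁻¹) : H = ⊥ := by
  refine subgroup_eq_bot_of_conj_into_two_factors hij H 1 g' ?_ hj
  intro x hx
  obtain ⟨a, ha⟩ := hi hx
  exact ⟨a, by simpa using ha.symm⟩

omit [DecidableEq ι] in
/-- "CELL PATTERNS ARE DEAD" (Q3(ii)(c), algebraic core): if every factor is a free group (all extra
flat pieces simply connected: each `G_m` is then free), every subgroup of the free product is free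
(free product of free groups is free; Nielsen–Schreier).  So a non-free group — e.g. the fundamental
group of a closed prime 3-manifold other than `S³`, `S² × S¹` — does not embed. -/
theorem subgroup_isFreeGroup_of_factors_free [∀ i, IsFreeGroup (G i)]
    (H : Subgroup (CoprodI G)) : IsFreeGroup H := inferInstance

omit [DecidableEq ι] in
/-- Embedding form: a group that embeds in a free product of free groups is free. -/
theorem isFreeGroup_of_injective_into_coprod_of_free [∀ i, IsFreeGroup (G i)]
    {K : Type*} [Group K] (f : K →* CoprodI G) (hf : Function.Injective f) : IsFreeGroup K :=
  IsFreeGroup.ofMulEquiv (MonoidHom.ofInjective hf).symm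

end FreeProduct

end FreeFactor

end Summit.FinalStateConjecture.FinalStateConjecture.Theorems
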